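import Summits.NavierStokesRegularity.NavierStokesRegularity.Theorems.EfficiencyFloorNearSaturationNearMaximiserSeqCoreCentring
import HarnessLib

/-!
# Route `EfficiencyFloor`, crux `NearSaturationNearMaximiser` (stmt-NavierStokesRegularity-25482) on the
# `ProductionEfficiencyDecay` ladder (stmt-22866): ASYMPTOTIC PYTHAGORAS FROM WEAK CONVERGENCE

Def-free helper file, third of the group `…SeqCoreUpgrade` (p841029) / `…SeqCoreCentring`. The weak-profile hypotheses
there ask for the «asymptotic Pythagoras» identities `Z(u_k − w) → 1 − Z(w)`, `Pal(u_k − w) → 1 − Pal(w)` along a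
normalised sequence `u_k` (`Z = Pal = 1`). This file PROVES that they follow from WEAK CONVERGENCE TESTED ON THE LIMIT —
`∫⟪curl u_k, curl w⟫ → Z(w)` and `∫ Σᵢ⟪D(curl u_k)eᵢ, D(curl w)eᵢ⟫ → Pal(w)` — which is what a weak limit in `Ḣ¹ ∩ Ḣ²`
(Banach–Alaoglu) supplies, by the exact Hilbert-space expansions of `Z(u − w)` and `Pal(u − w)`:

* §7 `enstrophy_sub_expand`, `palinstrophy_sub_expand` — `Z(u − w) = Z(u) − 2∫⟪curl u, curl w⟫ + Z(w)` and
  `Pal(u − w) = Pal(u) − 2∫Σᵢ⟪D(curl u)eᵢ, D(curl w)eᵢ⟫ + Pal(w)` for `C^∞` fields with `D¹ ∈ L²` resp. `D² ∈ L²`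
  (with the integrability of the cross terms);
* §8 `enstrophy_pythagoras_of_pairing`, `palinstrophy_pythagoras_of_pairing` — the two asymptotic Pythagoras identities from
  the two pairing limits;
* §9 `compact_of_centredLocalWeakLimit`, `nearSaturationNearMaximiser_of_centredLocalWeakLimit` — BY NAME: stmt-25482 ⟸
  (P_w) «every CENTRED admissible sequence with `Z = Pal = 1`, `S → c⋆` has a subsequence and an ADMISSIBLE `w` with: local
  `L²` convergence of the vorticity on the centring ball, the two pairing limits (weak convergence tested on `w`), and the
  splitting `S(u_k − w) → c⋆ − S(w)`» — non-vanishing, Pythagoras and the upgrade being proved.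

HONEST FRAMING: (P_w) — Rellich on the centring ball, a weak limit, the Brezis–Lieb splitting of the cubic stretching and
the regularity (admissibility) of the limit — is NOT proved here; stmt-25482, `LerayFloorGap`, `ProductionEfficiencyDecay`
(stmt-22866) and Navier–Stokes regularity stay OPEN; no summit statement is proved. [folklore]
-/

-- the problem directory repeats the summit name (`NavierStokesRegularity/NavierStokesRegularity`)
set_option linter.dupNamespace false

noncomputable section

namespace Summit.NavierStokesRegularity.NavierStokesRegularity.Theorems

namespace NearSaturationNearMaximiser

namespace SeqCore

open Set MeasureTheory Filter Topology Function
open scoped InnerProductSpace ENNReal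
open Literature.Analysis.FluidPDE

/-! ## §7 Exact expansions of `Z(u − w)` and `Pal(u − w)` -/

/-- **Enstrophy of a difference, exactly**: `Z(u − w) = Z(u) − 2∫⟪curl u, curl w⟫ + Z(w)` for `C^∞` fields with `D¹ ∈ L²`,
and the cross term is integrable. [folklore] -/
theorem enstrophy_sub_expand {u w : EuclideanSpace ℝ (Fin 3) → EuclideanSpace ℝ (Fin 3)}
    (hu : ContDiff ℝ (⊤ : ℕ∞) u) (hu1 : ∫⁻ x, ‖iteratedFDeriv ℝ 1 u x‖ₑ ^ 2 < ⊤)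
    (hw : ContDiff ℝ (⊤ : ℕ∞) w) (hw1 : ∫⁻ x, ‖iteratedFDeriv ℝ 1 w x‖ₑ ^ 2 < ⊤) :
    Integrable (fun x => ⟪curl u x, curl w x⟫_ℝ) ∧
    (∫ x, ‖curl (u - w) x‖ ^ 2) = (∫ x, ‖curl u x‖ ^ 2) - 2 * (∫ x, ⟪curl u x, curl w x⟫_ℝ) + ∫ x, ‖curl w x‖ ^ 2 := by
  have Iu := (integrable_norm_curl_sq (hu.of_le (by norm_cast)) hu1).1
  have Iw := (integrable_norm_curl_sq (hw.of_le (by norm_cast)) hw1).1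
  have Iuw : Integrable (fun x => ⟪curl u x, curl w x⟫_ℝ) :=
    integrable_inner_of_memLp_two (RigidExit.ReferenceFlow.memLp_two_curl hu hu1)
      (RigidExit.ReferenceFlow.memLp_two_curl hw hw1)
  refine ⟨Iuw, ?_⟩
  have hsub : curl (u - w) = fun x => curl u x - curl w x :=
    curl_sub_eq (hu.differentiable (by simp)) (hw.differentiable (by simp))
  have hpt : ∀ x, ‖curl (u - w) x‖ ^ 2 = (‖curl u x‖ ^ 2 - 2 * ⟪curl u x, curl w x⟫_ℝ) + ‖curl w x‖ ^ 2 := fun x => by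
    rw [hsub]
    exact norm_sub_sq_real _ _
  simp_rw [hpt]
  rw [integral_add (f := fun x => ‖curl u x‖ ^ 2 - 2 * ⟪curl u x, curl w x⟫_ℝ) (g := fun x => ‖curl w x‖ ^ 2)
      (Iu.sub (Iuw.const_mul 2)) Iw,
    integral_sub (f := fun x => ‖curl u x‖ ^ 2) (g := fun x => 2 * ⟪curl u x, curl w x⟫_ℝ) Iu (Iuw.const_mul 2),
    integral_const_mul]

/-- Frobenius square of a difference: `|A − B|²_F = |A|²_F − 2Σᵢ⟪Aeᵢ, Beᵢ⟫ + |B|²_F` (standard basis of `ℝ³`). [folklore] -/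
theorem frobeniusNormSq_sub_expand (A B : EuclideanSpace ℝ (Fin 3) →L[ℝ] EuclideanSpace ℝ (Fin 3)) :
    frobeniusNormSq (A - B) = frobeniusNormSq A -
      2 * (∑ i, ⟪A (EuclideanSpace.basisFun (Fin 3) ℝ i), B (EuclideanSpace.basisFun (Fin 3) ℝ i)⟫_ℝ) + frobeniusNormSq B := by
  rw [frobeniusNormSq_eq_sum (EuclideanSpace.basisFun (Fin 3) ℝ), frobeniusNormSq_eq_sum (EuclideanSpace.basisFun (Fin 3) ℝ),
    frobeniusNormSq_eq_sum (EuclideanSpace.basisFun (Fin 3) ℝ)]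
  simp only [sub_apply, norm_sub_sq_real]
  rw [Finset.sum_add_distrib, Finset.sum_sub_distrib, Finset.mul_sum]

/-- The Frobenius cross term is dominated: `|Σᵢ⟪Aeᵢ, Beᵢ⟫| ≤ (|A|²_F + |B|²_F)/2`. [folklore] -/
theorem abs_frobenius_cross_le (A B : EuclideanSpace ℝ (Fin 3) →L[ℝ] EuclideanSpace ℝ (Fin 3)) :
    |∑ i, ⟪A (EuclideanSpace.basisFun (Fin 3) ℝ i), B (EuclideanSpace.basisFun (Fin 3) ℝ i)⟫_ℝ| ≤
      (frobeniusNormSq A + frobeniusNormSq B) / 2 := by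
  rw [frobeniusNormSq_eq_sum (EuclideanSpace.basisFun (Fin 3) ℝ), frobeniusNormSq_eq_sum (EuclideanSpace.basisFun (Fin 3) ℝ),
    ← Finset.sum_add_distrib, Finset.sum_div]
  refine (Finset.abs_sum_le_sum_abs _ _).trans (Finset.sum_le_sum fun i _ => ?_)
  have h := abs_real_inner_le_norm (A (EuclideanSpace.basisFun (Fin 3) ℝ i)) (B (EuclideanSpace.basisFun (Fin 3) ℝ i))
  nlinarith [sq_nonneg (‖A (EuclideanSpace.basisFun (Fin 3) ℝ i)‖ - ‖B (EuclideanSpace.basisFun (Fin 3) ℝ i)‖),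
    norm_nonneg (A (EuclideanSpace.basisFun (Fin 3) ℝ i)), norm_nonneg (B (EuclideanSpace.basisFun (Fin 3) ℝ i))]

/-- **Palinstrophy of a difference, exactly**: `Pal(u − w) = Pal(u) − 2∫Σᵢ⟪D(curl u)eᵢ, D(curl w)eᵢ⟫ + Pal(w)` for `C^∞`
fields with `D² ∈ L²`, and the cross term is integrable. [folklore] -/
theorem palinstrophy_sub_expand {u w : EuclideanSpace ℝ (Fin 3) → EuclideanSpace ℝ (Fin 3)}
    (hu : ContDiff ℝ (⊤ : ℕ∞) u) (hu2 : ∫⁻ x, ‖iteratedFDeriv ℝ 2 u x‖ₑ ^ 2 < ⊤)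
    (hw : ContDiff ℝ (⊤ : ℕ∞) w) (hw2 : ∫⁻ x, ‖iteratedFDeriv ℝ 2 w x‖ₑ ^ 2 < ⊤) :
    Integrable (fun x => ∑ i, ⟪fderiv ℝ (curl u) x (EuclideanSpace.basisFun (Fin 3) ℝ i),
      fderiv ℝ (curl w) x (EuclideanSpace.basisFun (Fin 3) ℝ i)⟫_ℝ) ∧
    (∫ x, frobeniusNormSq (fderiv ℝ (curl (u - w)) x)) = (∫ x, frobeniusNormSq (fderiv ℝ (curl u) x)) -
      2 * (∫ x, ∑ i, ⟪fderiv ℝ (curl u) x (EuclideanSpace.basisFun (Fin 3) ℝ i),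
        fderiv ℝ (curl w) x (EuclideanSpace.basisFun (Fin 3) ℝ i)⟫_ℝ) + ∫ x, frobeniusNormSq (fderiv ℝ (curl w) x) := by
  have hu3 : ContDiff ℝ 3 u := hu.of_le (by norm_cast)
  have hw3 : ContDiff ℝ 3 w := hw.of_le (by norm_cast)
  have hcu : ContDiff ℝ 1 (curl u) := contDiff_curl (n := 1) (hu.of_le (by exact_mod_cast le_top))
  have hcw : ContDiff ℝ 1 (curl w) := contDiff_curl (n := 1) (hw.of_le (by exact_mod_cast le_top))
  have Iu := (integrable_frobeniusNormSq_fderiv_curl hu3 hu2).1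
  have Iw := (integrable_frobeniusNormSq_fderiv_curl hw3 hw2).1
  -- the cross term: continuous and dominated by `(|D curl u|² + |D curl w|²)/2`
  have hcont : Continuous (fun x => ∑ i, ⟪fderiv ℝ (curl u) x (EuclideanSpace.basisFun (Fin 3) ℝ i),
      fderiv ℝ (curl w) x (EuclideanSpace.basisFun (Fin 3) ℝ i)⟫_ℝ) := by
    refine continuous_finsetSum _ fun i _ => ?_
    exact ((hcu.continuous_fderiv one_ne_zero).clm_apply continuous_const).inner
      ((hcw.continuous_fderiv one_ne_zero).clm_apply continuous_const)
  have Iuw : Integrable (fun x => ∑ i, ⟪fderiv ℝ (curl u) x (EuclideanSpace.basisFun (Fin 3) ℝ i),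
      fderiv ℝ (curl w) x (EuclideanSpace.basisFun (Fin 3) ℝ i)⟫_ℝ) := by
    refine ((Iu.add Iw).div_const 2).mono' hcont.aestronglyMeasurable (Eventually.of_forall fun x => ?_)
    rw [Real.norm_eq_abs]
    exact abs_frobenius_cross_le _ _
  refine ⟨Iuw, ?_⟩
  have hsub : curl (u - w) = fun x => curl u x - curl w x :=
    curl_sub_eq (hu.differentiable (by simp)) (hw.differentiable (by simp))
  have hfd : ∀ x, fderiv ℝ (curl (u - w)) x = fderiv ℝ (curl u) x - fderiv ℝ (curl w) x := fun x => by
    rw [hsub]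
    exact fderiv_fun_sub ((hcu.differentiable one_ne_zero) x) ((hcw.differentiable one_ne_zero) x)
  have hpt : ∀ x, frobeniusNormSq (fderiv ℝ (curl (u - w)) x) = (frobeniusNormSq (fderiv ℝ (curl u) x) -
      2 * ∑ i, ⟪fderiv ℝ (curl u) x (EuclideanSpace.basisFun (Fin 3) ℝ i),
        fderiv ℝ (curl w) x (EuclideanSpace.basisFun (Fin 3) ℝ i)⟫_ℝ) + frobeniusNormSq (fderiv ℝ (curl w) x) := fun x => by
    rw [hfd x]
    exact frobeniusNormSq_sub_expand _ _
  simp_rw [hpt]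
  rw [integral_add (f := fun x => frobeniusNormSq (fderiv ℝ (curl u) x) -
      2 * ∑ i, ⟪fderiv ℝ (curl u) x (EuclideanSpace.basisFun (Fin 3) ℝ i), fderiv ℝ (curl w) x (EuclideanSpace.basisFun (Fin 3) ℝ i)⟫_ℝ)
      (g := fun x => frobeniusNormSq (fderiv ℝ (curl w) x)) (Iu.sub (Iuw.const_mul 2)) Iw,
    integral_sub (f := fun x => frobeniusNormSq (fderiv ℝ (curl u) x))
      (g := fun x => 2 * ∑ i, ⟪fderiv ℝ (curl u) x (EuclideanSpace.basisFun (Fin 3) ℝ i),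
        fderiv ℝ (curl w) x (EuclideanSpace.basisFun (Fin 3) ℝ i)⟫_ℝ) Iu (Iuw.const_mul 2),
    integral_const_mul]

/-! ## §8 Asymptotic Pythagoras from the pairing limits -/

/-- **Asymptotic Pythagoras for the enstrophy from weak convergence tested on the limit**: if `Z(u_k) = 1` and
`∫⟪curl u_k, curl w⟫ → Z(w)` then `Z(u_k − w) → 1 − Z(w)`. [folklore] -/
theorem enstrophy_pythagoras_of_pairing {u : ℕ → EuclideanSpace ℝ (Fin 3) → EuclideanSpace ℝ (Fin 3)}
    {w : EuclideanSpace ℝ (Fin 3) → EuclideanSpace ℝ (Fin 3)} (hu : ∀ k, ContDiff ℝ (⊤ : ℕ∞) (u k))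
    (hu1 : ∀ k, ∫⁻ x, ‖iteratedFDeriv ℝ 1 (u k) x‖ₑ ^ 2 < ⊤) (hw : ContDiff ℝ (⊤ : ℕ∞) w)
    (hw1 : ∫⁻ x, ‖iteratedFDeriv ℝ 1 w x‖ₑ ^ 2 < ⊤) (hZ1 : ∀ k, (∫ x, ‖curl (u k) x‖ ^ 2) = 1)
    (hpair : Tendsto (fun k => ∫ x, ⟪curl (u k) x, curl w x⟫_ℝ) atTop (𝓝 (∫ x, ‖curl w x‖ ^ 2))) :
    Tendsto (fun k => ∫ x, ‖curl (u k - w) x‖ ^ 2) atTop (𝓝 (1 - ∫ x, ‖curl w x‖ ^ 2)) := by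
  have heq : ∀ k, (∫ x, ‖curl (u k - w) x‖ ^ 2) = 1 - 2 * (∫ x, ⟪curl (u k) x, curl w x⟫_ℝ) + ∫ x, ‖curl w x‖ ^ 2 :=
    fun k => by rw [(enstrophy_sub_expand (hu k) (hu1 k) hw hw1).2, hZ1 k]
  have hlim : Tendsto (fun k => 1 - 2 * (∫ x, ⟪curl (u k) x, curl w x⟫_ℝ) + ∫ x, ‖curl w x‖ ^ 2) atTop
      (𝓝 (1 - 2 * (∫ x, ‖curl w x‖ ^ 2) + ∫ x, ‖curl w x‖ ^ 2)) :=
    ((hpair.const_mul 2).const_sub 1).add_const _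
  have h1 : (1 - 2 * (∫ x, ‖curl w x‖ ^ 2) + ∫ x, ‖curl w x‖ ^ 2) = 1 - ∫ x, ‖curl w x‖ ^ 2 := by ring
  rw [h1] at hlim
  exact hlim.congr fun k => (heq k).symm

/-- **Asymptotic Pythagoras for the palinstrophy from weak convergence tested on the limit**: if `Pal(u_k) = 1` and
`∫Σᵢ⟪D(curl u_k)eᵢ, D(curl w)eᵢ⟫ → Pal(w)` then `Pal(u_k − w) → 1 − Pal(w)`. [folklore] -/
theorem palinstrophy_pythagoras_of_pairing {u : ℕ → EuclideanSpace ℝ (Fin 3) → EuclideanSpace ℝ (Fin 3)}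
    {w : EuclideanSpace ℝ (Fin 3) → EuclideanSpace ℝ (Fin 3)} (hu : ∀ k, ContDiff ℝ (⊤ : ℕ∞) (u k))
    (hu2 : ∀ k, ∫⁻ x, ‖iteratedFDeriv ℝ 2 (u k) x‖ₑ ^ 2 < ⊤) (hw : ContDiff ℝ (⊤ : ℕ∞) w)
    (hw2 : ∫⁻ x, ‖iteratedFDeriv ℝ 2 w x‖ₑ ^ 2 < ⊤)
    (hP1 : ∀ k, (∫ x, frobeniusNormSq (fderiv ℝ (curl (u k)) x)) = 1)
    (hpair : Tendsto (fun k => ∫ x, ∑ i, ⟪fderiv ℝ (curl (u k)) x (EuclideanSpace.basisFun (Fin 3) ℝ i),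
      fderiv ℝ (curl w) x (EuclideanSpace.basisFun (Fin 3) ℝ i)⟫_ℝ) atTop (𝓝 (∫ x, frobeniusNormSq (fderiv ℝ (curl w) x)))) :
    Tendsto (fun k => ∫ x, frobeniusNormSq (fderiv ℝ (curl (u k - w)) x)) atTop
      (𝓝 (1 - ∫ x, frobeniusNormSq (fderiv ℝ (curl w) x))) := by
  have heq : ∀ k, (∫ x, frobeniusNormSq (fderiv ℝ (curl (u k - w)) x)) =
      1 - 2 * (∫ x, ∑ i, ⟪fderiv ℝ (curl (u k)) x (EuclideanSpace.basisFun (Fin 3) ℝ i),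
        fderiv ℝ (curl w) x (EuclideanSpace.basisFun (Fin 3) ℝ i)⟫_ℝ) + ∫ x, frobeniusNormSq (fderiv ℝ (curl w) x) :=
    fun k => by rw [(palinstrophy_sub_expand (hu k) (hu2 k) hw hw2).2, hP1 k]
  have hlim : Tendsto (fun k => 1 - 2 * (∫ x, ∑ i, ⟪fderiv ℝ (curl (u k)) x (EuclideanSpace.basisFun (Fin 3) ℝ i),
      fderiv ℝ (curl w) x (EuclideanSpace.basisFun (Fin 3) ℝ i)⟫_ℝ) + ∫ x, frobeniusNormSq (fderiv ℝ (curl w) x)) atTop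
      (𝓝 (1 - 2 * (∫ x, frobeniusNormSq (fderiv ℝ (curl w) x)) + ∫ x, frobeniusNormSq (fderiv ℝ (curl w) x))) :=
    ((hpair.const_mul 2).const_sub 1).add_const _
  have h1 : (1 - 2 * (∫ x, frobeniusNormSq (fderiv ℝ (curl w) x)) + ∫ x, frobeniusNormSq (fderiv ℝ (curl w) x)) =
      1 - ∫ x, frobeniusNormSq (fderiv ℝ (curl w) x) := by ring
  rw [h1] at hlim
  exact hlim.congr fun k => (heq k).symm

/-! ## §9 By name: compactness from a centred local WEAK LIMIT -/

/-- **COMPACTNESS from centred local weak limits.** As `compact_of_centredLocalProfile`, with the two asymptotic Pythagoras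
clauses replaced by the two PAIRING LIMITS (weak convergence of `curl u_k`, `D curl u_k` tested on the limit `w`). [folklore] -/
theorem compact_of_centredLocalWeakLimit {c : ℝ} (hc : 0 < c)
    (hadm : ∀ f : EuclideanSpace ℝ (Fin 3) → EuclideanSpace ℝ (Fin 3), (ContDiff ℝ (⊤ : ℕ∞) f ∧
      Literature.Analysis.FluidPDE.VectorCalculus.IsDivFree f ∧ (∫⁻ x, ‖iteratedFDeriv ℝ 0 f x‖ₑ ^ 2 < ⊤) ∧
      (∫⁻ x, ‖iteratedFDeriv ℝ 1 f x‖ₑ ^ 2 < ⊤) ∧ (∫⁻ x, ‖iteratedFDeriv ℝ 2 f x‖ₑ ^ 2 < ⊤)) → (∫ x,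
      ⟪Literature.Analysis.FluidPDE.curl f x, fderiv ℝ f x (Literature.Analysis.FluidPDE.curl f x)⟫_ℝ) ≤ c *
      (∫ x, ‖Literature.Analysis.FluidPDE.curl f x‖ ^ 2) ^ (3 / 4 : ℝ) * (∫ x,
      Literature.Analysis.FluidPDE.frobeniusNormSq (fderiv ℝ (Literature.Analysis.FluidPDE.curl f) x)) ^ (3 / 4 : ℝ))
    (HWw : ∀ K δ : ℝ, 0 < K → 0 < δ → ∀ v : ℕ → EuclideanSpace ℝ (Fin 3) → EuclideanSpace ℝ (Fin 3),
      (∀ n, ContDiff ℝ (⊤ : ℕ∞) (v n) ∧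
      Literature.Analysis.FluidPDE.VectorCalculus.IsDivFree (v n) ∧ (∫⁻ x, ‖iteratedFDeriv ℝ 0 (v n) x‖ₑ ^ 2 < ⊤) ∧
      (∫⁻ x, ‖iteratedFDeriv ℝ 1 (v n) x‖ₑ ^ 2 < ⊤) ∧ (∫⁻ x, ‖iteratedFDeriv ℝ 2 (v n) x‖ₑ ^ 2 < ⊤)) →
      (∀ n, (∫ x, ‖Literature.Analysis.FluidPDE.curl (v n) x‖ ^ 2) = 1) →
      (∀ n, (∫ x, Literature.Analysis.FluidPDE.frobeniusNormSq (fderiv ℝ (Literature.Analysis.FluidPDE.curl (v n)) x)) = 1) →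
      Tendsto (fun n => ∫ x, ⟪Literature.Analysis.FluidPDE.curl (v n) x, fderiv ℝ (v n) x
        (Literature.Analysis.FluidPDE.curl (v n) x)⟫_ℝ) atTop (𝓝 c) →
      (∀ᶠ n in atTop, δ ≤ ∫ x in Metric.ball (0 : EuclideanSpace ℝ (Fin 3)) K, ‖Literature.Analysis.FluidPDE.curl (v n) x‖ ^ 2) →
      ∃ w : EuclideanSpace ℝ (Fin 3) → EuclideanSpace ℝ (Fin 3), (ContDiff ℝ (⊤ : ℕ∞) w ∧
        Literature.Analysis.FluidPDE.VectorCalculus.IsDivFree w ∧ (∫⁻ x, ‖iteratedFDeriv ℝ 0 w x‖ₑ ^ 2 < ⊤) ∧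
        (∫⁻ x, ‖iteratedFDeriv ℝ 1 w x‖ₑ ^ 2 < ⊤) ∧ (∫⁻ x, ‖iteratedFDeriv ℝ 2 w x‖ₑ ^ 2 < ⊤)) ∧
        ∃ φ : ℕ → ℕ, StrictMono φ ∧
        Tendsto (fun k => ∫ x in Metric.ball (0 : EuclideanSpace ℝ (Fin 3)) K,
          ‖Literature.Analysis.FluidPDE.curl (v (φ k) - w) x‖ ^ 2) atTop (𝓝 0) ∧
        Tendsto (fun k => ∫ x, ⟪Literature.Analysis.FluidPDE.curl (v (φ k)) x, Literature.Analysis.FluidPDE.curl w x⟫_ℝ)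
          atTop (𝓝 (∫ x, ‖Literature.Analysis.FluidPDE.curl w x‖ ^ 2)) ∧
        Tendsto (fun k => ∫ x, ∑ i, ⟪fderiv ℝ (Literature.Analysis.FluidPDE.curl (v (φ k))) x (EuclideanSpace.basisFun (Fin 3) ℝ i),
          fderiv ℝ (Literature.Analysis.FluidPDE.curl w) x (EuclideanSpace.basisFun (Fin 3) ℝ i)⟫_ℝ) atTop
          (𝓝 (∫ x, Literature.Analysis.FluidPDE.frobeniusNormSq (fderiv ℝ (Literature.Analysis.FluidPDE.curl w) x))) ∧
        Tendsto (fun k => ∫ x, ⟪Literature.Analysis.FluidPDE.curl (v (φ k) - w) x, fderiv ℝ (v (φ k) - w) x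
          (Literature.Analysis.FluidPDE.curl (v (φ k) - w) x)⟫_ℝ) atTop
          (𝓝 (c - ∫ x, ⟪Literature.Analysis.FluidPDE.curl w x, fderiv ℝ w x (Literature.Analysis.FluidPDE.curl w x)⟫_ℝ))) :
    ∀ v : ℕ → EuclideanSpace ℝ (Fin 3) → EuclideanSpace ℝ (Fin 3), (∀ n, ContDiff ℝ (⊤ : ℕ∞) (v n) ∧
      Literature.Analysis.FluidPDE.VectorCalculus.IsDivFree (v n) ∧ (∫⁻ x, ‖iteratedFDeriv ℝ 0 (v n) x‖ₑ ^ 2 < ⊤) ∧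
      (∫⁻ x, ‖iteratedFDeriv ℝ 1 (v n) x‖ₑ ^ 2 < ⊤) ∧ (∫⁻ x, ‖iteratedFDeriv ℝ 2 (v n) x‖ₑ ^ 2 < ⊤)) →
      (∀ n, (∫ x, ‖Literature.Analysis.FluidPDE.curl (v n) x‖ ^ 2) = 1) →
      (∀ n, (∫ x, Literature.Analysis.FluidPDE.frobeniusNormSq (fderiv ℝ (Literature.Analysis.FluidPDE.curl (v n)) x)) = 1) →
      Tendsto (fun n => ∫ x, ⟪Literature.Analysis.FluidPDE.curl (v n) x, fderiv ℝ (v n) x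
        (Literature.Analysis.FluidPDE.curl (v n) x)⟫_ℝ) atTop (𝓝 c) →
      ∃ w : EuclideanSpace ℝ (Fin 3) → EuclideanSpace ℝ (Fin 3), (ContDiff ℝ (⊤ : ℕ∞) w ∧
        Literature.Analysis.FluidPDE.VectorCalculus.IsDivFree w ∧ (∫⁻ x, ‖iteratedFDeriv ℝ 0 w x‖ₑ ^ 2 < ⊤) ∧
        (∫⁻ x, ‖iteratedFDeriv ℝ 1 w x‖ₑ ^ 2 < ⊤) ∧ (∫⁻ x, ‖iteratedFDeriv ℝ 2 w x‖ₑ ^ 2 < ⊤)) ∧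
        ∃ (a : ℕ → EuclideanSpace ℝ (Fin 3)) (φ : ℕ → ℕ), StrictMono φ ∧
        Tendsto (fun k => ∫ x, ‖Literature.Analysis.FluidPDE.curl ((fun x => v (φ k) (x - a k)) - w) x‖ ^ 2) atTop (𝓝 0) ∧
        Tendsto (fun k => ∫ x, Literature.Analysis.FluidPDE.frobeniusNormSq (fderiv ℝ
          (Literature.Analysis.FluidPDE.curl ((fun x => v (φ k) (x - a k)) - w)) x)) atTop (𝓝 0) := by
  refine compact_of_centredLocalProfile hc hadm fun K δ hK hδ v hAdm hZ1 hP1 hS hcen => ?_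
  obtain ⟨w, hw, φ, hφ, hloc, hpZ, hpP, hSspl⟩ := HWw K δ hK hδ v hAdm hZ1 hP1 hS hcen
  exact ⟨w, hw, φ, hφ, hloc,
    enstrophy_pythagoras_of_pairing (fun k => (hAdm (φ k)).1) (fun k => (hAdm (φ k)).2.2.2.1) hw.1 hw.2.2.2.1
      (fun k => hZ1 (φ k)) hpZ,
    palinstrophy_pythagoras_of_pairing (fun k => (hAdm (φ k)).1) (fun k => (hAdm (φ k)).2.2.2.2) hw.1 hw.2.2.2.2
      (fun k => hP1 (φ k)) hpP, hSspl⟩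

/-- **`NearSaturationNearMaximiser` (stmt-25482) from centred local WEAK LIMITS, BY NAME.** Assumed: (P_w) — for the sharp
constant, every centred admissible sequence with `Z = Pal = 1`, `S → c⋆` has a subsequence and an ADMISSIBLE `w` with local
`L²` convergence of the vorticity on the centring ball (Rellich), weak convergence of `curl`, `D curl` tested on `w`
(Banach–Alaoglu), and the splitting `S(u_k − w) → c⋆ − S(w)` (Brezis–Lieb). Proved (this group of files): non-vanishing,
asymptotic Pythagoras, the upgrade, the sequential core, the item. NOT proved here: (P_w). [folklore] -/
theorem nearSaturationNearMaximiser_of_centredLocalWeakLimit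
    (HWw : ∀ c : ℝ, (0 < c ∧ (∀ v : EuclideanSpace ℝ (Fin 3) → EuclideanSpace ℝ (Fin 3), (ContDiff ℝ (⊤ : ℕ∞) v ∧
      Literature.Analysis.FluidPDE.VectorCalculus.IsDivFree v ∧ (∫⁻ x, ‖iteratedFDeriv ℝ 0 v x‖ₑ ^ 2 < ⊤) ∧
      (∫⁻ x, ‖iteratedFDeriv ℝ 1 v x‖ₑ ^ 2 < ⊤) ∧ (∫⁻ x, ‖iteratedFDeriv ℝ 2 v x‖ₑ ^ 2 < ⊤)) → (∫ x,
      ⟪Literature.Analysis.FluidPDE.curl v x, fderiv ℝ v x (Literature.Analysis.FluidPDE.curl v x)⟫_ℝ) ≤ c *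
      (∫ x, ‖Literature.Analysis.FluidPDE.curl v x‖ ^ 2) ^ (3 / 4 : ℝ) * (∫ x,
      Literature.Analysis.FluidPDE.frobeniusNormSq (fderiv ℝ (Literature.Analysis.FluidPDE.curl v) x)) ^ (3 /
      4 : ℝ)) ∧ ∀ c' : ℝ, (∀ w : EuclideanSpace ℝ (Fin 3) → EuclideanSpace ℝ (Fin 3), (ContDiff ℝ (⊤ : ℕ∞) w ∧
      Literature.Analysis.FluidPDE.VectorCalculus.IsDivFree w ∧ (∫⁻ x, ‖iteratedFDeriv ℝ 0 w x‖ₑ ^ 2 < ⊤) ∧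
      (∫⁻ x, ‖iteratedFDeriv ℝ 1 w x‖ₑ ^ 2 < ⊤) ∧ (∫⁻ x, ‖iteratedFDeriv ℝ 2 w x‖ₑ ^ 2 < ⊤)) → (∫ x,
      ⟪Literature.Analysis.FluidPDE.curl w x, fderiv ℝ w x (Literature.Analysis.FluidPDE.curl w x)⟫_ℝ) ≤ c' *
      (∫ x, ‖Literature.Analysis.FluidPDE.curl w x‖ ^ 2) ^ (3 / 4 : ℝ) * (∫ x,
      Literature.Analysis.FluidPDE.frobeniusNormSq (fderiv ℝ (Literature.Analysis.FluidPDE.curl w) x)) ^ (3 /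
      4 : ℝ)) → c ≤ c') →
      ∀ K δ : ℝ, 0 < K → 0 < δ → ∀ v : ℕ → EuclideanSpace ℝ (Fin 3) → EuclideanSpace ℝ (Fin 3),
      (∀ n, ContDiff ℝ (⊤ : ℕ∞) (v n) ∧
      Literature.Analysis.FluidPDE.VectorCalculus.IsDivFree (v n) ∧ (∫⁻ x, ‖iteratedFDeriv ℝ 0 (v n) x‖ₑ ^ 2 < ⊤) ∧
      (∫⁻ x, ‖iteratedFDeriv ℝ 1 (v n) x‖ₑ ^ 2 < ⊤) ∧ (∫⁻ x, ‖iteratedFDeriv ℝ 2 (v n) x‖ₑ ^ 2 < ⊤)) →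
      (∀ n, (∫ x, ‖Literature.Analysis.FluidPDE.curl (v n) x‖ ^ 2) = 1) →
      (∀ n, (∫ x, Literature.Analysis.FluidPDE.frobeniusNormSq (fderiv ℝ (Literature.Analysis.FluidPDE.curl (v n)) x)) = 1) →
      Tendsto (fun n => ∫ x, ⟪Literature.Analysis.FluidPDE.curl (v n) x, fderiv ℝ (v n) x
        (Literature.Analysis.FluidPDE.curl (v n) x)⟫_ℝ) atTop (𝓝 c) →
      (∀ᶠ n in atTop, δ ≤ ∫ x in Metric.ball (0 : EuclideanSpace ℝ (Fin 3)) K, ‖Literature.Analysis.FluidPDE.curl (v n) x‖ ^ 2) →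
      ∃ w : EuclideanSpace ℝ (Fin 3) → EuclideanSpace ℝ (Fin 3), (ContDiff ℝ (⊤ : ℕ∞) w ∧
        Literature.Analysis.FluidPDE.VectorCalculus.IsDivFree w ∧ (∫⁻ x, ‖iteratedFDeriv ℝ 0 w x‖ₑ ^ 2 < ⊤) ∧
        (∫⁻ x, ‖iteratedFDeriv ℝ 1 w x‖ₑ ^ 2 < ⊤) ∧ (∫⁻ x, ‖iteratedFDeriv ℝ 2 w x‖ₑ ^ 2 < ⊤)) ∧
        ∃ φ : ℕ → ℕ, StrictMono φ ∧
        Tendsto (fun k => ∫ x in Metric.ball (0 : EuclideanSpace ℝ (Fin 3)) K,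
          ‖Literature.Analysis.FluidPDE.curl (v (φ k) - w) x‖ ^ 2) atTop (𝓝 0) ∧
        Tendsto (fun k => ∫ x, ⟪Literature.Analysis.FluidPDE.curl (v (φ k)) x, Literature.Analysis.FluidPDE.curl w x⟫_ℝ)
          atTop (𝓝 (∫ x, ‖Literature.Analysis.FluidPDE.curl w x‖ ^ 2)) ∧
        Tendsto (fun k => ∫ x, ∑ i, ⟪fderiv ℝ (Literature.Analysis.FluidPDE.curl (v (φ k))) x (EuclideanSpace.basisFun (Fin 3) ℝ i),
          fderiv ℝ (Literature.Analysis.FluidPDE.curl w) x (EuclideanSpace.basisFun (Fin 3) ℝ i)⟫_ℝ) atTop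
          (𝓝 (∫ x, Literature.Analysis.FluidPDE.frobeniusNormSq (fderiv ℝ (Literature.Analysis.FluidPDE.curl w) x))) ∧
        Tendsto (fun k => ∫ x, ⟪Literature.Analysis.FluidPDE.curl (v (φ k) - w) x, fderiv ℝ (v (φ k) - w) x
          (Literature.Analysis.FluidPDE.curl (v (φ k) - w) x)⟫_ℝ) atTop
          (𝓝 (c - ∫ x, ⟪Literature.Analysis.FluidPDE.curl w x, fderiv ℝ w x (Literature.Analysis.FluidPDE.curl w x)⟫_ℝ))) :
    Summit.NavierStokesRegularity.NavierStokesRegularity.Theses.EfficiencyFloor.NearSaturationNearMaximiser :=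
  nearSaturationNearMaximiser_of_compact fun c hsharp =>
    compact_of_centredLocalWeakLimit hsharp.1 (fun f hf => hsharp.2.1 f hf) (HWw c hsharp)

end SeqCore

end NearSaturationNearMaximiser

end Summit.NavierStokesRegularity.NavierStokesRegularity.Theorems

end
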